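import Literature.NumberTheory.LFunctions.WeilTwoPrimeOddMarginEDef
import HarnessLib

/-!
# Two-prime odd-margin certificate E: the value of `κ`, `0 ≤ κ' ≤ κ`, and the scalar side conditions

`weilCert23E.kappaQ` evaluated by the kernel (it involves the `|γ|`-moment `ν'_abs` and `max_j bnd_j` over the 248 cells), the margin inequalities for `κ' = weilCert23EKappa'`, and `checkScalars` with `κ` rewritten to its value first. Pure proof file.
-/

noncomputable section

namespace Literature.NumberTheory.LFunctions

set_option maxHeartbeats 0 in
/-- **The value of `κ`** of certificate E. [folklore] -/
theorem kappaQ_weilCert23E : weilCert23E.kappaQ = weilCert23EKappaLit := by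
  have h : decide (weilCert23E.kappaQ = weilCert23EKappaLit) = true := by decide +kernel
  exact of_decide_eq_true h

/-- `0 ≤ κ' ≤ κ` for certificate E (`κ − κ' = 1/2000000`). [folklore] -/
theorem kappa'_nonneg_le_weilCert23E : 0 ≤ weilCert23EKappa' ∧ weilCert23EKappa' ≤ weilCert23E.kappaQ := by
  rw [kappaQ_weilCert23E]; unfold weilCert23EKappa' weilCert23EKappaLit; norm_num

/-- The margin `κ − κ'` of certificate E is at least `1/2000000`. [folklore] -/
theorem margin_weilCert23E : (1/2000000 : ℚ) ≤ weilCert23E.kappaQ - weilCert23EKappa' := by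
  rw [kappaQ_weilCert23E]; unfold weilCert23EKappa' weilCert23EKappaLit; norm_num

set_option maxHeartbeats 0 in
/-- **Kernel check of the scalar side conditions** of certificate E (`0 < b ≤ a₀ ≤ 1`, `2a₀T ≤ N+2`, Taylor remainder, `N+1 = 2nb`, `κ ≥ 0`), with `κ` rewritten to its value first. [folklore] -/
theorem checkScalars_weilCert23E : weilCert23E.checkScalars = true := by
  have h : weilCert23E.checkScalars = (decide (1 ≤ weilCert23E.j) && decide (0 < weilCert23E.b) && decide (weilCert23E.b ≤ weilCert23E.base.a0) &&
      decide (weilCert23E.base.a0 ≤ 1) && decide (0 < weilCert23E.base.T) && decide (2 * weilCert23E.base.a0 * weilCert23E.base.T ≤ (weilCert23E.base.N : ℚ) + 2) &&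
      decide (2 * (weilCert23E.base.a0 * weilCert23E.base.T) ^ (weilCert23E.base.N + 1) / (weilCert23E.base.N + 1).factorial ≤ 1) &&
      decide (weilCert23E.base.N + 1 = 2 * weilCert23E.base.nb) && decide (0 ≤ weilCert23E.kappaQ)) := rfl
  rw [h, kappaQ_weilCert23E]
  decide +kernel

end Literature.NumberTheory.LFunctions
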